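import Mathlib
import Literature.NumberTheory.Transcendental.RoyCriterion
import Literature.NumberTheory.Transcendental.RoySmallValueEstimates
import Literature.NumberTheory.Transcendental.RoySmallValueEstimatesEndgameAssemblyProofs
import Summits.Schanuel.Schanuel.Theses.RoyCriterion

/-!
# Sketch — first lemmas for two crux ideas on `NguyenRoySmallValueTranslates` (stmt-Schanuel-1051)

Crux (fixed): `Summit.Schanuel.Schanuel.Theses.RoyCriterion.NguyenRoySmallValueTranslates`
= Nguyen–Roy 2016 Thm 1 with `ν > 2 + β − σ` on the whole range `1 ≤ σ < 2`.

Both first lemmas are stated over the tree's abstract endgame record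
`Literature.NumberTheory.Transcendental.NguyenRoy.EndgameData σ β ν`
(RoySmallValueEstimatesEndgameAssemblyProofs.lean), whose `false_of_constraints` is §6 of the paper
with the PRINTED two-case constraint on `ν`.  The lemmas below replace the printed constraint by
the Dirichlet-edge constraint `2 + β − σ < ν` for ALL `1 ≤ σ < 2`, at the price of one extra
hypothesis each; the cards explain where the extra hypothesis comes from.
-/

noncomputable section

open Finset Filter
open scoped Classical

namespace Summit.Schanuel.Schanuel.Cruxes.NguyenRoySmallValueTranslates.Sketch

open Literature.NumberTheory.Transcendental
open Literature.NumberTheory.Transcendental.NguyenRoy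

/-- CARD 1 (self-liouville-concentration), first lemma — **the concentrated case closes at the
Dirichlet edge, for every `1 ≤ σ < 2`.**  Extra hypothesis `hconc`: at arbitrarily large levels
`D`, ONE point `a₀` of `Z_D` alone carries half of Corollary 16's bound (closest index `ι a₀`).
Claimed proof: recentre at `m := ι a₀`, take `D*` as in (6.1), run the `notIn` polynomial
`Φʲ(P̃_{D*})` on `τ^{T*−1}(Z̃_D)` exactly as in `EndgameData.case2_core`; the single point's
closeness `κ/2 · D^{ν+σ−2} · (2 D^β deg + D^{1−β}·D·ht)` beats the Liouville cost
`c₇ D* deg + D*(ht + c₄ T deg) + 3(D*)^β deg` because `ν + σ − 2 > β`, `ν + σ − β − 1 > 1`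
and `β > σ + 1`; the complementary sub-case `v(a₀) ≤ e^{−(D*)^ν/2}` dies by (6.3) as printed. -/
def ConcentratedCaseCloses (σ β ν : ℝ) : Prop :=
  ∀ E : EndgameData σ β ν, 1 ≤ σ → σ < 2 → σ + 1 < β → 2 + β - σ < ν →
    (∃ᶠ D : ℕ in atTop, ∃ ι : E.Pt → ℤ,
      (∀ a ∈ E.pts (E.Z D), 0 ≤ ι a ∧ ι a < (⌊(D : ℝ) ^ σ⌋₊ : ℕ)) ∧
      (∑ a ∈ E.pts (E.Z D), ((D : ℝ) ^ β + Real.log (E.dist a (E.γ (ι a)))) ≤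
        -(E.κ * (D : ℝ) ^ (ν - β + σ - 2) *
          (2 * (D : ℝ) ^ β * (E.pts (E.Z D)).card + D * E.ht (E.Z D)))) ∧
      ∃ a₀ ∈ E.pts (E.Z D),
        (D : ℝ) ^ β + Real.log (E.dist a₀ (E.γ (ι a₀))) ≤
          -(E.κ / 2 * (D : ℝ) ^ (ν - β + σ - 2) *
            (2 * (D : ℝ) ^ β * (E.pts (E.Z D)).card + D * E.ht (E.Z D)))) →
    False

/-- CARD 1, the self-Liouville (autocorrelation) inequality the dichotomy rests on, as an
abstract statement over `EndgameData`: two DISTINCT points of the same `Z_D`, aligned by the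
rational translation `τ^{ι a' − ι a}`, cannot both be closer to their orbit points than the
Liouville budget of the pair `(Z_D, τ^{ι a'−ι a} Z_D)` — which costs only `2·deg·ht` of `Z_D`
itself (no second variety, no level `D*`).  Extra hypotheses beyond `EndgameData`: Galois-orbit
rigidity (`hgal`: a variety sharing a point with a translate of itself IS that translate) and the
printed fixed-point exclusion (`hfix`: no `Z_D` is `τ`-periodic; NR2016 proof of Prop. 14). -/
def SelfLiouvillePair (σ β ν : ℝ) : Prop :=
  ∀ E : EndgameData σ β ν,
    (∀ (Z : E.V) (i : ℤ) (b : E.Pt), b ∈ E.pts Z → b ∈ E.pts (E.τV i Z) →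
        E.pts (E.τV i Z) = E.pts Z) →
    (∀ (D : ℕ) (i : ℤ), E.D₀ ≤ D → i ≠ 0 → E.pts (E.τV i (E.Z D)) ≠ E.pts (E.Z D)) →
    ∀ (D : ℕ), E.D₀ ≤ D → ∀ (ι : E.Pt → ℤ), ∀ a ∈ E.pts (E.Z D), ∀ a' ∈ E.pts (E.Z D), a ≠ a' →
      min (-Real.log (E.dist a (E.γ (ι a)))) (-Real.log (E.dist a' (E.γ (ι a'))))
        ≤ E.c₁₂ * (E.pts (E.Z D)).card ^ 2
          + 2 * (E.pts (E.Z D)).card * (E.ht (E.Z D) + E.c₄ * |((ι a' - ι a : ℤ) : ℝ)| * (E.pts (E.Z D)).card)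
          + E.c₁ * |((ι a' - ι a : ℤ) : ℝ)| + Real.log 4

/-- CARD 2 (index-collapse-discriminant), abstract endgame core — **if the close points of `Z_D`
collapse onto ONE orbit index and the same-index pairs obey a discriminant-type aggregate bound
(total cost `deg·ht + C deg² (1 + D^σ)` for ALL same-index pairs at once, instead of `2 deg·ht`
per pair), then contradiction at the Dirichlet edge.**  It reduces to `ConcentratedCaseCloses`
plus bookkeeping (`prop14` at the own level: `deg ≤ A₁₄ D^{2−σ}`, `ht ≤ B₁₄ D^{1+β−σ}`). -/
def SameIndexDiscriminantCloses (σ β ν : ℝ) : Prop :=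
  ∀ E : EndgameData σ β ν, 1 ≤ σ → σ < 2 → σ + 1 < β → 2 + β - σ < ν → ∀ C : ℝ, 0 ≤ C →
    (∃ᶠ D : ℕ in atTop, ∃ ι : E.Pt → ℤ,
      (∀ a ∈ E.pts (E.Z D), 0 ≤ ι a ∧ ι a < (⌊(D : ℝ) ^ σ⌋₊ : ℕ)) ∧
      (∑ a ∈ E.pts (E.Z D), ((D : ℝ) ^ β + Real.log (E.dist a (E.γ (ι a)))) ≤
        -(E.κ * (D : ℝ) ^ (ν - β + σ - 2) *
          (2 * (D : ℝ) ^ β * (E.pts (E.Z D)).card + D * E.ht (E.Z D)))) ∧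
      ∃ k₀ : ℤ, ∃ a₁ ∈ E.pts (E.Z D),
        -- collapse: off-index points are not "very close"
        (∀ a ∈ E.pts (E.Z D), ι a ≠ k₀ →
          -((D : ℝ) ^ β + Real.log (E.dist a (E.γ (ι a)))) ≤
            E.ht (E.Z D) + C * (E.pts (E.Z D)).card * D) ∧
        -- discriminant aggregate: all same-index points but one fit in ONE budget
        (∑ a ∈ ((E.pts (E.Z D)).erase a₁).filter (fun a => ι a = k₀),
            max 0 (-((D : ℝ) ^ β + Real.log (E.dist a (E.γ (ι a))))) ≤
          (E.pts (E.Z D)).card * E.ht (E.Z D)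
            + C * (E.pts (E.Z D)).card ^ 2 * (1 + (D : ℝ) ^ σ))) →
    False

/-- CARD 2, the concrete first target of the line: **the crux at the Dirichlet edge when the
additive coordinate `ξ` is algebraic** (then Liouville makes `x(α) = ξ + k r` EXACT for every
very close approximant, Galois collapses all close conjugates onto one index, and the
discriminant of the minimal polynomial of `y(α)` aggregates all close pairs).  Same shape as the
crux decl with the extra hypothesis `IsAlgebraic ℚ ξ`; conclusion `IsAlgebraic ℚ η`. -/
def EdgeCaseAlgebraicXi : Prop :=
  ∀ (ξ η : ℂ), IsAlgebraic ℚ ξ → η ≠ 0 → ∀ (r s : ℚ), r ≠ 0 → s ≠ 0 → s ≠ 1 → s ≠ -1 →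
    ∀ (σ β ν : ℝ), 1 ≤ σ → σ < 2 → σ + 1 < β → 2 + β - σ < ν →
    (∀ᶠ D : ℕ in Filter.atTop, ∃ P : MvPolynomial (Fin 2) ℤ, P ≠ 0 ∧ P.totalDegree ≤ D ∧
      (mvPolyHeight P : ℝ) ≤ Real.exp ((D : ℝ) ^ β) ∧
      ∀ i : ℕ, i < 4 * ⌊(D : ℝ) ^ σ⌋₊ →
        ‖MvPolynomial.aeval ![ξ + (i : ℂ) * (r : ℂ), η * (s : ℂ) ^ i] P‖ ≤ Real.exp (-(D : ℝ) ^ ν)) →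
    IsAlgebraic ℚ η

/-- The symmetric target: `η` algebraic forces `ξ` algebraic at the edge. -/
def EdgeCaseAlgebraicEta : Prop :=
  ∀ (ξ η : ℂ), IsAlgebraic ℚ η → η ≠ 0 → ∀ (r s : ℚ), r ≠ 0 → s ≠ 0 → s ≠ 1 → s ≠ -1 →
    ∀ (σ β ν : ℝ), 1 ≤ σ → σ < 2 → σ + 1 < β → 2 + β - σ < ν →
    (∀ᶠ D : ℕ in Filter.atTop, ∃ P : MvPolynomial (Fin 2) ℤ, P ≠ 0 ∧ P.totalDegree ≤ D ∧
      (mvPolyHeight P : ℝ) ≤ Real.exp ((D : ℝ) ^ β) ∧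
      ∀ i : ℕ, i < 4 * ⌊(D : ℝ) ^ σ⌋₊ →
        ‖MvPolynomial.aeval ![ξ + (i : ℂ) * (r : ℂ), η * (s : ℂ) ^ i] P‖ ≤ Real.exp (-(D : ℝ) ^ ν)) →
    IsAlgebraic ℚ ξ

/-- Sanity link: the two edge sub-cases together with the crux's own shape — the crux implies
both (trivially), so they are genuine SUB-cases of the fixed crux decl. -/
theorem crux_implies_subcases
    (h : Summit.Schanuel.Schanuel.Theses.RoyCriterion.NguyenRoySmallValueTranslates) :
    EdgeCaseAlgebraicXi ∧ EdgeCaseAlgebraicEta := by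
  refine ⟨?_, ?_⟩
  · intro ξ η _ hη r s hr hs0 hs1 hs2 σ β ν h1 h2 h3 h4 hP
    exact (h ξ η hη r s hr hs0 hs1 hs2 σ β ν h1 h2 h3 h4 hP).2
  · intro ξ η _ hη r s hr hs0 hs1 hs2 σ β ν h1 h2 h3 h4 hP
    exact (h ξ η hη r s hr hs0 hs1 hs2 σ β ν h1 h2 h3 h4 hP).1

end Summit.Schanuel.Schanuel.Cruxes.NguyenRoySmallValueTranslates.Sketch

end
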